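import Literature.NumberTheory.EllipticCurves.ManinConstantQuadraticTwistIstarProofs
import Literature.NumberTheory.EllipticCurves.ManinConstantQuadraticTwistAtTwoProofs
import Literature.NumberTheory.EllipticCurves.ManinConstantClassCertificateTwist
import Summits.BirchSwinnertonDyer.Rank1Residual.Additive.GordManinConstantTwistDegree
import HarnessLib

/-!
# Route `TeichmullerTwistDescent`, cruxes SCMU57 (stmt-BirchSwinnertonDyer-22639) and PSMU
# (stmt-BirchSwinnertonDyer-22638): THE STAR INVOLUTION ON THE MANIN VALUATION — the ramified
# quadratic twist `χ_{p*}` moves the Manin `p`-part between the Kodaira types X and X* (`--supports`)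

Cell `pub/bsd-wall` (D-0145 line route-BirchSwinnertonDyer-TeichmullerTwistDescent, OPEN rev 1), seat
`bsd-line-ttd-p1` (prover 1/2, g2, item SCMU57). THEOREMS ONLY (no definition, no named fact, no
`sorry`); nothing is booked, no item is closed, BSD is not proved by this.

WHAT. At an additive potentially good prime `p ≥ 5` the quadratic twist by `χ_{p*}`
(`p* = (−1)^{(p−1)/2} p`) is an involution of the Manin residue which exchanges the Kodaira types
II ↔ IV*, III ↔ III*, IV ↔ II* (`ord_p Δ_min ↦ ord_p Δ_min ± 6`), preserves additivity, the conductor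
(`N(E ⊗ χ_{p*}) = N(E)`), irreducibility of `E[p]` and (§2 of the companion file) the Weil type
(principal series ↔ principal series, supercuspidal ↔ supercuspidal). Edixhoven 1991 §4 (typescript
L602–640) reads the twist on the period lattices of the two STRONG curves: `δΛ ⊂ Λ̃ ⊂ δ⁻¹Λ`,
`δ² = p*`. This file proves the two inclusions ONE AT A TIME, inside the tree, at EVERY odd `p` (no
`p > 7`, no stable model of `X₀(p²N)`), in the tree's `Γ₀` vocabulary (lattice-optimal
`ModularParametrizationData`, the `Γ₀` twisting theorem `gaussSum_mul_mem_periodLattice_of_mem_charTwist`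
= Stevens 1989 (5.4) on `Γ₀(N)`, and the Néron mapping property
`integral_neronScaling_of_isGloballyMinimal_holds`), and draws the consequence for the Manin
VALUATIONS of a twist pair:

* §1 `exists_int_mul_eq_of_charTwist_gamma0` — the tree's chain `maninConstant_dvd_of_charTwist_gamma0`
  (there: `Λ_C = g(χ)⁻¹Λ_A` exactly) with a rational SCALAR `r`: if `Λ_C ⊇ r·g(χ)⁻¹·Λ_A` then
  `r·c(D') = k·c(D)`, `k ∈ ℤ`; `p`-adically `ord_p c(D) ≤ ord_p r + ord_p c(D')`
  (`padicValInt_le_of_int_mul_eq`).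
* §2 `mem_lattice_twist_pStar_iff` — for `C • X^{(p*)} = Y` the Néron lattices satisfy
  `Λ_Y = u(C)·g⁻¹·Λ_X`, `g = g(χ_p)` the Gauss sum of the Legendre character (`g² = p*`); the two
  transfers `g y ∈ Λ_X ⟹ u y ∈ Λ_Y` and `g y ∈ Λ_Y ⟹ (p*/u) y ∈ Λ_X`.
  `unstarred_twist_of_starred` — the `p`-adic dictionary from the STARRED side (companion of the cell
  `b2b-bsdres` theorem `Additive.unstarred_partner_of_twist_pStar`, which starts from the unstarred
  side): for `W` additive potentially good of type IV*/III*/II* and `C • W^{(p*)} = V` globally minimal,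
  `V` is additive potentially good of type II/III/IV, `ord_p Δ_min(V) + 6 = ord_p Δ_min(W)`, and
  **`ord_p u(C) = 1`** (from the unstarred side it is `0`, `Additive.padicValRat_u_eq_zero_…`).
* §3 **`padicValInt_c_le_of_twist_datum`: `ord_p c(D) ≤ 1 − ord_p u(C) + ord_p c(D')`** for the
  lattice-optimal datum `D` of a globally minimal `W` additive at `p` (level `N`, `p² ∣ N`), ANY
  globally minimal model `C • W^{(p*)} = V` of the twist and ANY datum `D'` of `V` at a level `N' ∣ N`.
  Hence the ASYMMETRY of the involution: `not_dvd_c_of_twist_datum` — **a `p`-good datum on the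
  UNSTARRED twist gives `p ∤ c` for the STARRED optimal curve** (`ord_p u = 1`); and
  `padicValInt_c_le_one_of_twist_datum` — **a `p`-good datum on the STARRED twist gives only
  `ord_p c ≤ 1` for the UNSTARRED optimal curve** (`ord_p u = 0`) — Edixhoven's printed "at most
  once" (Thm. 3, exceptional case), which the tree's renderings of Thm. 3 do not transcribe, obtained
  here at every odd `p` from a `p`-good datum on the twist.

USE (companion file `TeichmullerTwistDescentStarInvolutionCells.lean`): the on-curve cells (SC57) and
(PS57) of `TeichmullerTwistDescentPrincipalSeriesCells.lean` — hence SCMU57 and the `p ∈ {5, 7}` half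
of PSMU, hence AKR's stub S57 — FOLLOW FROM THEIR UNSTARRED HALVES (types II/IV at `5`, III at `7` for
SC; III at `5`, II/IV at `7` for PS), granted Modularity. What this does NOT do: it proves no cell;
the unstarred halves stay open (Edixhoven's method needs the semistability defect `e < p − 1` and his
supersingular parity argument is printed for `p > 7` only; the corner is type II at `5`).

References: [EdixhovenManin1991] Progr. Math. 89 (1991), Thm. 3, §4 (typescript L115–118,
L602–640, L695–710); [Stevens1989] Invent. Math. 98 (1989), Lemmas (5.2), (5.4); [Shimura1971]
Prop. 3.64; [Pal2012] Prop. 2.5, Lemma 3.1; [SilvermanAEC2009] VII.1.3(b), X.2 Ex. 10.16.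
-/

set_option autoImplicit false
-- single-conjunct summit: `Summit.BirchSwinnertonDyer.BirchSwinnertonDyer.…` repeats the name by design
set_option linter.dupNamespace false

noncomputable section

open scoped Classical NumberField

open WeierstrassCurve IsDedekindDomain Rat.HeightOneSpectrum
  Literature.NumberTheory.EllipticCurves Literature.NumberTheory.EllipticCurves.ModularForms
  Literature.NumberTheory.EllipticCurves.Rank1Residual Literature.NumberTheory.DiophantineGeometry
  Summit.BirchSwinnertonDyer.Rank1Residual Summit.BirchSwinnertonDyer.Rank1Residual.Additive

namespace Summit.BirchSwinnertonDyer.BirchSwinnertonDyer.Theorems.TeichmullerTwistDescentStarInvolution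

/-! ### §1 The `Γ₀` twisting chain with a scalar -/

/-- **The `Γ₀` twisting chain with a scalar.** Data: a lattice-optimal `X₀(N)`-datum `D` of a
globally minimal `W` (`Λ_W = c·Λ(f_D)`), any `X₀(N')`-datum `D'` of any curve `A`
(`c'·Λ(f_{D'}) ⊆ Λ_A`), a primitive quadratic `χ` mod `m` with `N' ∣ N`, `m² ∣ N` and
`aₙ(f_D) = χ(n)·aₙ(f_{D'})` (so `f_D` is the twist `(f_{D'})_χ` at level `N`), a globally minimal
`C` with a Néron-type pair `LC`, and a rational `r` such that `r·y ∈ Λ_C` whenever `g(χ)·y ∈ Λ_A`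
(i.e. `Λ_C ⊇ r·g(χ)⁻¹·Λ_A`). Then `r·c' = k·c` for an integer `k`: by the `Γ₀` twisting theorem
`g(χ)·Λ(f_D) ⊆ Λ(f_{D'})` (`gaussSum_mul_mem_periodLattice_of_mem_charTwist`, Stevens (5.4)/(5.5)
on `Γ₀(N)` = Shimura 1971 Prop. 3.64), `(r c'/c)·Λ_W ⊆ Λ_C`, and a rational scaling between the
Néron lattices of two globally minimal curves is integral (Néron mapping property, tree theorem
`integral_neronScaling_of_isGloballyMinimal_holds`). The case `r = 1`, `Λ_C = g(χ)⁻¹Λ_A` is the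
tree's `maninConstant_dvd_of_charTwist_gamma0`. [cite: Stevens1989, Lemma (5.4) p. 97 and (2.8) p. 88]
[cite: Shimura1971, Prop. 3.64] [cite: SilvermanATAEC1994, IV.5.1 with IV.6.1 and Cor. IV.9.1] -/
theorem exists_int_mul_eq_of_charTwist_gamma0
    {A : WeierstrassCurve ℚ} {N' : ℕ} [NeZero N']
    {W : WeierstrassCurve ℚ} [W.IsElliptic] [W.IsGloballyMinimal] {N : ℕ} [NeZero N]
    {m : ℕ} [NeZero m] {χ : DirichletCharacter ℂ m}
    {C : WeierstrassCurve ℚ} [C.IsElliptic] [C.IsGloballyMinimal] {LC : PeriodPair}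
    (D' : ModularParametrizationData A N') (D : ModularParametrizationData W N)
    (h : ∀ z ∈ D.L.lattice, ∃ w ∈ periodLattice D.f, z = D.c * w)
    (hχ : χ.IsQuadratic) (hprim : χ.IsPrimitive) (hN : N' ∣ N) (hm : m ^ 2 ∣ N)
    (hf : ∀ n : ℕ, cuspCoeff D.f n = χ n * cuspCoeff D'.f n)
    (hC : IsNeronLatticeOf (C.baseChange ℂ) LC) (r : ℚ)
    (hLC : ∀ y : ℂ, gaussSum χ (ZMod.stdAddChar (N := m)) * y ∈ D'.L.lattice →
      (r : ℂ) * y ∈ LC.lattice) :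
    ∃ k : ℤ, r * D'.c = k * D.c := by
  set G : ℂ := gaussSum χ (ZMod.stdAddChar (N := m)) with hG
  have hfeq : D.f = charTwist N hN hm hχ D'.f :=
    eq_of_forall_cuspCoeff_eq_gamma0 fun n ↦ by rw [hf, cuspCoeff_charTwist N hN hm hχ hprim]
  have hc : D.c ≠ 0 := D.maninConstant_ne_zero_holds
  have hcℂ : (D.c : ℂ) ≠ 0 := by exact_mod_cast hc
  -- `(r c'/c) Λ_W ⊆ Λ_C`
  have key : ∀ z ∈ D.L.lattice, (((r * D'.c / D.c : ℚ)) : ℂ) * z ∈ LC.lattice := by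
    intro z hz
    obtain ⟨w, hw, rfl⟩ := h z hz
    have hw' : G * w ∈ periodLattice D'.f := by
      rw [hfeq] at hw
      exact gaussSum_mul_mem_periodLattice_of_mem_charTwist N hN hm hχ hprim D'.f hw
    have h3 : (D'.c : ℂ) * (G * w) ∈ D'.L.lattice := D'.smul_periodLattice_le _ hw'
    have h4 : (r : ℂ) * ((D'.c : ℂ) * w) ∈ LC.lattice := by
      refine hLC _ ?_
      rw [← mul_assoc, mul_comm G, mul_assoc]
      exact h3
    convert h4 using 1
    push_cast
    field_simp
  obtain ⟨k, hk⟩ :=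
    integral_neronScaling_of_isGloballyMinimal_holds W C D.L LC D.isNeronLattice hC _ key
  have hcℚ : (D.c : ℚ) ≠ 0 := by exact_mod_cast hc
  refine ⟨k, ?_⟩
  rw [hk]
  field_simp

/-- `p`-adic reading of §1: if `r ≠ 0` then `ord_p c ≤ ord_p r + ord_p c'`. [folklore] -/
theorem padicValInt_le_of_int_mul_eq {p : ℕ} [hp : Fact p.Prime] {r : ℚ} {c c' k : ℤ}
    (hr : r ≠ 0) (hc : c ≠ 0) (hc' : c' ≠ 0) (h : r * c' = k * c) :
    (padicValInt p c : ℤ) ≤ padicValRat p r + padicValInt p c' := by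
  have hk : k ≠ 0 := by
    rintro rfl
    exact (mul_ne_zero hr (Int.cast_ne_zero.mpr hc')) (by simpa using h)
  have h1 : padicValRat p (r * c') = padicValRat p ((k : ℚ) * c) := by rw [h]
  rw [padicValRat.mul hr (by exact_mod_cast hc'),
    padicValRat.mul (by exact_mod_cast hk) (by exact_mod_cast hc), padicValRat.of_int,
    padicValRat.of_int, padicValRat.of_int] at h1
  have hk0 : (0 : ℤ) ≤ padicValInt p k := by positivity
  linarith

/-! ### §2 The Néron lattice of a globally minimal model of the `p*`-twist -/

section Twist

variable (p : ℕ) [hp : Fact p.Prime]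

/-- **The Néron lattice across a `p*`-twist, with the scaling.** For `C • X^{(p*)} = Y` over `ℚ`
(`X`, `Y` elliptic, Néron-type pairs `LX`, `LY`), `Λ_Y = u(C) · g⁻¹ · Λ_X` where `g = g(χ_p)` is the
Gauss sum of the Legendre character mod `p` (`g² = p*`): the twisted model `X^{(p*)}` has invariants
`p*² c₄, p*³ c₆` (tree `isNeronLatticeOf_quadraticTwist_of_sq_eq`, Pal 2012 Lemma 3.1
"`ω(E^d) = ω(E)/√d`"), and a change of variables scales the Néron lattice by `u`
(`IsNeronLatticeOf.lattice_eq_mulLeft_of_smul`). Membership form: `x ∈ Λ_Y ↔ g·u⁻¹·x ∈ Λ_X`.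
[cite: Pal2012, Lemma 3.1] [cite: SilvermanAEC2009, III.1 Table 3.1 (PDF p. 50)] -/
theorem mem_lattice_twist_pStar_iff (hp2 : p ≠ 2) (X Y : WeierstrassCurve ℚ) [X.IsElliptic]
    [Y.IsElliptic] {LX LY : PeriodPair} (hLX : IsNeronLatticeOf (X.baseChange ℂ) LX)
    (hLY : IsNeronLatticeOf (Y.baseChange ℂ) LY) (C : VariableChange ℚ)
    (hC : C • X.quadraticTwist ((-1 : ℚ) ^ (p / 2) * p) = Y) (x : ℂ) :
    x ∈ LY.lattice ↔
      gaussSum ((quadraticChar (ZMod p)).ringHomComp (Int.castRingHom ℂ))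
          (ZMod.stdAddChar (N := p)) * ((((C.u : ℚ) : ℂ))⁻¹ * x) ∈ LX.lattice := by
  set G : ℂ := gaussSum ((quadraticChar (ZMod p)).ringHomComp (Int.castRingHom ℂ))
    (ZMod.stdAddChar (N := p)) with hGdef
  have hG2 : G ^ 2 = (((-1 : ℤ) ^ (p / 2) * p : ℤ) : ℂ) := gaussSum_quadraticChar_ringHomComp_sq p hp2
  have hd0 : (((-1 : ℤ) ^ (p / 2) * p : ℤ) : ℂ) ≠ 0 := by
    have h : ((-1 : ℤ) ^ (p / 2) * p : ℤ) ≠ 0 :=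
      mul_ne_zero (pow_ne_zero _ (by norm_num)) (by exact_mod_cast hp.out.ne_zero)
    exact_mod_cast h
  have hG0 : G ≠ 0 := by
    intro h
    rw [h, zero_pow two_ne_zero] at hG2
    exact hd0 hG2.symm
  have hLT : IsNeronLatticeOf ((X.quadraticTwist ((-1 : ℚ) ^ (p / 2) * p)).baseChange ℂ)
      (LX.mulLeft G⁻¹ (inv_ne_zero hG0)) :=
    isNeronLatticeOf_quadraticTwist_of_sq_eq ((-1 : ℚ) ^ (p / 2) * p) hLX hG0
      (by rw [hG2]; push_cast; ring)
  have hLY' : IsNeronLatticeOf ((C • X.quadraticTwist ((-1 : ℚ) ^ (p / 2) * p)).baseChange ℂ) LY := by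
    rw [hC]; exact hLY
  have hΛ := IsNeronLatticeOf.lattice_eq_mulLeft_of_smul C hLT hLY'
  rw [hΛ, PeriodPair.mem_mulLeft_lattice, PeriodPair.mem_mulLeft_lattice, inv_inv]

/-- **Transfer INTO the twist**: if `g·y ∈ Λ_X` then `u·y ∈ Λ_Y` (`Λ_Y = u g⁻¹ Λ_X`). [folklore] -/
theorem smul_mem_lattice_twist_of_gaussSum_mul_mem (hp2 : p ≠ 2) (X Y : WeierstrassCurve ℚ)
    [X.IsElliptic] [Y.IsElliptic] {LX LY : PeriodPair} (hLX : IsNeronLatticeOf (X.baseChange ℂ) LX)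
    (hLY : IsNeronLatticeOf (Y.baseChange ℂ) LY) (C : VariableChange ℚ)
    (hC : C • X.quadraticTwist ((-1 : ℚ) ^ (p / 2) * p) = Y) (y : ℂ)
    (hy : gaussSum ((quadraticChar (ZMod p)).ringHomComp (Int.castRingHom ℂ))
      (ZMod.stdAddChar (N := p)) * y ∈ LX.lattice) :
    (((C.u : ℚ) : ℚ) : ℂ) * y ∈ LY.lattice := by
  rw [mem_lattice_twist_pStar_iff p hp2 X Y hLX hLY C hC]
  have hu : (((C.u : ℚ) : ℚ) : ℂ) ≠ 0 := by exact_mod_cast C.u.ne_zero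
  rwa [← mul_assoc (((C.u : ℚ) : ℂ))⁻¹, inv_mul_cancel₀ hu, one_mul]

/-- **Transfer OUT OF the twist**: if `g·y ∈ Λ_Y` then `(p*/u)·y ∈ Λ_X` (`g² = p*`). [folklore] -/
theorem smul_mem_lattice_of_gaussSum_mul_mem_twist (hp2 : p ≠ 2) (X Y : WeierstrassCurve ℚ)
    [X.IsElliptic] [Y.IsElliptic] {LX LY : PeriodPair} (hLX : IsNeronLatticeOf (X.baseChange ℂ) LX)
    (hLY : IsNeronLatticeOf (Y.baseChange ℂ) LY) (C : VariableChange ℚ)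
    (hC : C • X.quadraticTwist ((-1 : ℚ) ^ (p / 2) * p) = Y) (y : ℂ)
    (hy : gaussSum ((quadraticChar (ZMod p)).ringHomComp (Int.castRingHom ℂ))
      (ZMod.stdAddChar (N := p)) * y ∈ LY.lattice) :
    (((((-1 : ℤ) ^ (p / 2) * p : ℤ) : ℚ) / (C.u : ℚ) : ℚ) : ℂ) * y ∈ LX.lattice := by
  set G : ℂ := gaussSum ((quadraticChar (ZMod p)).ringHomComp (Int.castRingHom ℂ))
    (ZMod.stdAddChar (N := p)) with hGdef
  have hG2 : G ^ 2 = (((-1 : ℤ) ^ (p / 2) * p : ℤ) : ℂ) := gaussSum_quadraticChar_ringHomComp_sq p hp2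
  rw [mem_lattice_twist_pStar_iff p hp2 X Y hLX hLY C hC] at hy
  have hu : (((C.u : ℚ) : ℚ) : ℂ) ≠ 0 := by exact_mod_cast C.u.ne_zero
  convert hy using 1
  have : G * ((((C.u : ℚ) : ℚ) : ℂ)⁻¹ * (G * y)) = G ^ 2 * ((((C.u : ℚ) : ℚ) : ℂ)⁻¹ * y) := by ring
  rw [this, hG2]
  push_cast
  ring

/-- **The `p*`-twist of a STARRED optimal curve, as a globally minimal model.** Let `W/ℚ` be globally
minimal, additive and potentially good at `p ≥ 5` (`0 ≤ ord_p j`) of STARRED Kodaira type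
(`6 < ord_p Δ_min(W)`: IV* / III* / II*), and `C • W^{(p*)} = V` globally minimal. Then `V` is
additive and potentially good at `p` of the UNSTARRED type with `ord_p Δ_min(V) + 6 = ord_p Δ_min(W)`
(so `ord_p Δ_min(V) ≤ 4`), and the scaling has **`ord_p u(C) = 1`**: `Δ_min(V) = u⁻¹² p*⁶ Δ_min(W)`
(`Additive.padicValInt_minimalDiscriminantInt_twist_pStar_eq`) with both `ord_p Δ_min ∈ {2, …, 10}`
(Kodaira at `p ≥ 5`, `Additive.padicValInt_minimalDiscriminantInt_mem_of_addv_of_padicValRat_j_nonneg`).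
Companion of `Additive.unstarred_partner_of_twist_pStar` (there the change of variables goes from the
unstarred twist to `W`, here from the twisted model of `W` to its minimal model).
[cite: SilvermanATAEC1994, IV Table 4.1 (PDF p. 365)] [cite: Pal2012, Prop. 2.5] -/
theorem unstarred_twist_of_starred (hp5 : 5 ≤ p) (W V : WeierstrassCurve ℚ) [W.IsElliptic]
    [W.IsGloballyMinimal] [V.IsElliptic] [V.IsGloballyMinimal] (hW : Addv W p)
    (hjW : 0 ≤ padicValRat p W.j) (h6 : 6 < padicValInt p W.minimalDiscriminantInt)
    (C : VariableChange ℚ) (hC : C • W.quadraticTwist ((-1 : ℚ) ^ (p / 2) * p) = V) :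
    Addv V p ∧ 0 ≤ padicValRat p V.j ∧
      padicValInt p V.minimalDiscriminantInt + 6 = padicValInt p W.minimalDiscriminantInt ∧
      padicValInt p V.minimalDiscriminantInt ≤ 4 ∧ padicValRat p (C.u : ℚ) = 1 := by
  have hd0 : ((-1 : ℚ) ^ (p / 2) * p) ≠ 0 := pStar_ne_zero p
  haveI : (W.quadraticTwist ((-1 : ℚ) ^ (p / 2) * p)).IsElliptic := W.isElliptic_quadraticTwist hd0
  have hrel := padicValInt_minimalDiscriminantInt_twist_pStar_eq p W V C hC
  have hjV : V.j = W.j := by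
    subst hC
    rw [variableChange_j, W.j_quadraticTwist hd0]
  have hjV' : 0 ≤ padicValRat p V.j := hjV ▸ hjW
  have hvW := padicValInt_minimalDiscriminantInt_mem_of_addv_of_padicValRat_j_nonneg W p hp5 hW hjW
  obtain ⟨m, hm⟩ : ∃ m : ℤ, padicValRat p (C.u : ℚ) = m := ⟨_, rfl⟩
  rw [hm] at hrel
  have hngood : ¬ Good V p := by
    intro hgood
    have h0 : padicValInt p V.minimalDiscriminantInt = 0 :=
      padicValInt.eq_zero_of_not_dvd (EisensteinPrimes.not_dvd_disc_of_good V p hgood)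
    rw [h0] at hrel
    omega
  have hnmult : ¬ Mult V p := fun hmult ↦
    not_lt.mpr hjV' (EisensteinPrimes.padicValRat_j_neg_of_mult V p hmult)
  have hV : Addv V p := ⟨hngood, hnmult⟩
  have hvV := padicValInt_minimalDiscriminantInt_mem_of_addv_of_padicValRat_j_nonneg V p hp5 hV hjV'
  refine ⟨hV, hjV', by omega, by omega, ?_⟩
  rw [hm]
  have : m = 1 := by omega
  rw [this]

end Twist

/-! ### §3 The star involution on the Manin constant: `c(W) ∣ (p*/u)·c(D')` -/

section Chain

variable (p : ℕ) [hp : Fact p.Prime]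

/-- **The star involution on the Manin valuation.** Let `W/ℚ` be globally minimal, additive at the
odd prime `p`, with a LATTICE-OPTIMAL datum `D` at a level `N` with `p² ∣ N` (the `X₀(N)`-optimal
curve of its class and its Manin constant `c = c(D)`); let `C • W^{(p*)} = V` be a globally minimal
model of the `p*`-twist with scaling `u = u(C)`, and `D'` ANY datum of `V` at a level `N' ∣ N`. Then
**`ord_p c(D) ≤ 1 − ord_p u + ord_p c(D')`**. Chain (§1 with `A = V`, the curve `C` of §1 being `W`
itself, `r = p*/u`): `aₙ(f_D) = (n/p)·aₙ(f_{D'})` (`aₙ(W^{(p*)}) = (n/p) aₙ(W)` off `p`, tree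
`LFunction_quadraticTwist_pStar_apply`; at the multiples of `p` both sides vanish, `W` being additive),
`Λ_W = (p*/u)·g⁻¹·Λ_V` (§2), so `(p*/u)·c(D') = k·c(D)` with `k ∈ ℤ`. This is the lattice sandwich
`δΛ ⊂ Λ̃ ⊂ δ⁻¹Λ` of Edixhoven 1991 §4 read one inclusion at a time, at every odd `p` and with no
`p > 7`. [cite: EdixhovenManin1991, §4 (typescript L602–640)] [cite: Stevens1989, Lemma (5.4) p. 97]
[cite: SilvermanAEC2009, X.2 Exercise 10.16] -/
theorem padicValInt_c_le_of_twist_datum (hp2 : p ≠ 2) (W V : WeierstrassCurve ℚ) [W.IsElliptic]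
    [W.IsGloballyMinimal] [V.IsElliptic] [V.IsGloballyMinimal] (hW : Addv W p)
    (C : VariableChange ℚ) (hC : C • W.quadraticTwist ((-1 : ℚ) ^ (p / 2) * p) = V)
    {N : ℕ} [NeZero N] (D : ModularParametrizationData W N)
    (hopt : ∀ z ∈ D.L.lattice, ∃ w ∈ periodLattice D.f, z = D.c * w) (hpN : p ^ 2 ∣ N)
    {N' : ℕ} [NeZero N'] (hN : N' ∣ N) (D' : ModularParametrizationData V N') :
    (padicValInt p D.c : ℤ) ≤ 1 - padicValRat p (C.u : ℚ) + padicValInt p D'.c := by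
  have hpP : p.Prime := hp.out
  haveI : (W.quadraticTwist ((-1 : ℚ) ^ (p / 2) * p)).IsElliptic :=
    W.isElliptic_quadraticTwist (pStar_ne_zero p)
  obtain ⟨hcast, hd⟩ := pStar_intCast p
  set d : ℤ := (-1 : ℤ) ^ (p / 2) * p with hddef
  have hd0 : (d : ℚ) ≠ 0 := by
    rcases hd with h | h <;> rw [h] <;> push_cast <;> simp [hpP.ne_zero]
  -- the Legendre character
  set χ := (quadraticChar (ZMod p)).ringHomComp (Int.castRingHom ℂ) with hχ
  have hχq := isQuadratic_quadraticChar_ringHomComp p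
  have hχp := isPrimitive_quadraticChar_ringHomComp p hp2
  -- `W` is additive at the place over `p`
  set vq : HeightOneSpectrum ℤ := (primesEquiv (R := ℤ)).symm ⟨p, hpP⟩ with hvq
  have haddW : W.HasAdditiveReductionAt vq := by
    rcases W.hasGoodReductionAt_or_hasMultiplicativeReductionAt_or_hasAdditiveReductionAt vq with
      hg | hm | ha
    · exact absurd ((W.hasGoodReductionAtPrime_iff_hasGoodReductionAt_holds ⟨p, hpP⟩).mpr hg) hW.1
    · exact absurd
        ((W.hasMultiplicativeReductionAtPrime_iff_hasMultiplicativeReductionAt_holds ⟨p, hpP⟩).mpr hm)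
        hW.2
    · exact ha
  -- the coefficient relation `aₙ(f_D) = χ(n) aₙ(f_{D'})`
  have hcoef : ∀ n : ℕ, cuspCoeff D.f n = χ n * cuspCoeff D'.f n := by
    intro n
    rw [D.isNewformOf.2 n, D'.isNewformOf.2 n, hχ, quadraticChar_ringHomComp_apply_natCast p n, ← hC,
      LFunction_smul]
    by_cases hpn : p ∣ n
    · have h0 : legendreSym p n = 0 :=
        (legendreSym.eq_zero_iff p n).mpr (by exact_mod_cast (ZMod.natCast_eq_zero_iff n p).mpr hpn)
      have hvO : (primesEquiv ((primesEquiv (R := 𝓞 ℚ)).symm ⟨p, hpP⟩) : ℕ) = p := by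
        rw [Equiv.apply_symm_apply]
      have haddO : W.HasAdditiveReductionAt ((primesEquiv (R := 𝓞 ℚ)).symm ⟨p, hpP⟩) :=
        (W.hasAdditiveReductionAt_int_iff_ringOfIntegers ⟨p, hpP⟩).mp haddW
      rw [W.LFunction_apply_eq_zero_of_hasAdditiveReductionAt hvO haddO hpn, h0]
      push_cast
      ring
    · rw [← hcast, W.LFunction_quadraticTwist_pStar_apply hp2 hpn]
      have hne : ((n : ℤ) : ZMod p) ≠ 0 := by
        rw [Int.cast_natCast, Ne, ZMod.natCast_eq_zero_iff]
        exact hpn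
      push_cast
      rcases legendreSym.eq_one_or_neg_one p hne with h1 | h1
      · rw [show (legendreSym p (n : ℤ)) = legendreSym p n from rfl, h1]; push_cast; ring
      · rw [show (legendreSym p (n : ℤ)) = legendreSym p n from rfl, h1]; push_cast; ring
  -- the lattice transfer out of the twist: `g y ∈ Λ_V ⟹ (p*/u) y ∈ Λ_W`
  set r : ℚ := (d : ℚ) / (C.u : ℚ) with hr
  have hLC : ∀ y : ℂ, gaussSum χ (ZMod.stdAddChar (N := p)) * y ∈ D'.L.lattice →
      (r : ℂ) * y ∈ D.L.lattice := fun y hy ↦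
    smul_mem_lattice_of_gaussSum_mul_mem_twist p hp2 W V D.isNeronLattice D'.isNeronLattice C hC y hy
  -- the chain
  obtain ⟨k, hk⟩ := exists_int_mul_eq_of_charTwist_gamma0 D' D hopt hχq hχp hN
    (by exact_mod_cast hpN) hcoef D.isNeronLattice r hLC
  -- valuations
  have hu0 : (C.u : ℚ) ≠ 0 := C.u.ne_zero
  have hr0 : r ≠ 0 := div_ne_zero hd0 hu0
  have hdv : padicValRat p (d : ℚ) = 1 := by
    rcases hd with h | h <;> rw [h]
    · push_cast; exact_mod_cast padicValRat.self hpP.one_lt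
    · push_cast; rw [padicValRat.neg]; exact_mod_cast padicValRat.self hpP.one_lt
  have hrv : padicValRat p r = 1 - padicValRat p (C.u : ℚ) := by
    rw [hr, padicValRat.div hd0 hu0, hdv]
  have hc0 : D.c ≠ 0 := D.maninConstant_ne_zero_holds
  have hc0' : D'.c ≠ 0 := D'.maninConstant_ne_zero_holds
  have hle := padicValInt_le_of_int_mul_eq (p := p) hr0 hc0 hc0' hk
  rw [hrv] at hle
  exact hle

/-- **STARRED optimal from the unstarred twist** (`ord_p u = 1`, the case of
`unstarred_twist_of_starred`): if SOME datum `D'` of the unstarred twist `V` at a level `N' ∣ N` has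
`p ∤ c(D')`, then the lattice-optimal datum of `W` has `p ∤ c(D)` — `ord_p c(D) ≤ 0 + 0`. This is
the direction in which the Manin `p`-part TRANSFERS across the involution; the other direction only
bounds (`padicValInt_c_le_one_of_twist_datum`). [cite: EdixhovenManin1991, §4 (typescript L602–640)] -/
theorem not_dvd_c_of_twist_datum (hp2 : p ≠ 2) (W V : WeierstrassCurve ℚ) [W.IsElliptic]
    [W.IsGloballyMinimal] [V.IsElliptic] [V.IsGloballyMinimal] (hW : Addv W p)
    (C : VariableChange ℚ) (hC : C • W.quadraticTwist ((-1 : ℚ) ^ (p / 2) * p) = V)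
    (hu : padicValRat p (C.u : ℚ) = 1) {N : ℕ} [NeZero N] (D : ModularParametrizationData W N)
    (hopt : ∀ z ∈ D.L.lattice, ∃ w ∈ periodLattice D.f, z = D.c * w) (hpN : p ^ 2 ∣ N)
    {N' : ℕ} [NeZero N'] (hN : N' ∣ N) (D' : ModularParametrizationData V N')
    (hc' : ¬ (p : ℤ) ∣ D'.c) : ¬ (p : ℤ) ∣ D.c := by
  have hle := padicValInt_c_le_of_twist_datum p hp2 W V hW C hC D hopt hpN hN D'
  rw [hu, padicValInt.eq_zero_of_not_dvd hc'] at hle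
  have hc0 : D.c ≠ 0 := D.maninConstant_ne_zero_holds
  have hdvd_iff : (p : ℤ) ∣ D.c ↔ 1 ≤ padicValInt p D.c := by
    rw [← pow_one (p : ℤ), padicValInt_dvd_iff]
    exact ⟨fun h' ↦ h'.resolve_left hc0, Or.inr⟩
  intro hdvd
  have h1 := hdvd_iff.mp hdvd
  push_cast at hle
  omega

/-- **UNSTARRED optimal from the starred twist: "at most once"** (`ord_p u = 0`, the case of the
tree's `Additive.padicValRat_u_eq_zero_and_padicValInt_eq_of_twist_pStar`, `ord_p Δ_min(W) < 6`):
if SOME datum `D'` of the starred twist `V` at a level `N' ∣ N` has `p ∤ c(D')`, then the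
lattice-optimal datum of `W` has `ord_p c(D) ≤ 1`. With Edixhoven 1991 Thm. 3 supplying `D'` at
`p ≥ 11` this is his printed clause "in that case, `p` divides `c` at most once" for the exceptional
types II/III/IV (not transcribed in the tree's renderings of Thm. 3), here at every odd `p` GIVEN a
`p`-good datum on the twist. [cite: EdixhovenManin1991, Thm. 3 (typescript L115–118) and §4] -/
theorem padicValInt_c_le_one_of_twist_datum (hp2 : p ≠ 2) (W V : WeierstrassCurve ℚ)
    [W.IsElliptic] [W.IsGloballyMinimal] [V.IsElliptic] [V.IsGloballyMinimal] (hW : Addv W p)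
    (C : VariableChange ℚ) (hC : C • W.quadraticTwist ((-1 : ℚ) ^ (p / 2) * p) = V)
    (hu : padicValRat p (C.u : ℚ) = 0) {N : ℕ} [NeZero N] (D : ModularParametrizationData W N)
    (hopt : ∀ z ∈ D.L.lattice, ∃ w ∈ periodLattice D.f, z = D.c * w) (hpN : p ^ 2 ∣ N)
    {N' : ℕ} [NeZero N'] (hN : N' ∣ N) (D' : ModularParametrizationData V N')
    (hc' : ¬ (p : ℤ) ∣ D'.c) : padicValInt p D.c ≤ 1 := by
  have hle := padicValInt_c_le_of_twist_datum p hp2 W V hW C hC D hopt hpN hN D'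
  rw [hu, padicValInt.eq_zero_of_not_dvd hc'] at hle
  push_cast at hle
  omega

end Chain

end Summit.BirchSwinnertonDyer.BirchSwinnertonDyer.Theorems.TeichmullerTwistDescentStarInvolution

end
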